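import Mathlib.Data.Real.Basic
import Mathlib.Algebra.Order.BigOperators.Ring.Finset
import Mathlib.Algebra.BigOperators.Intervals
import Mathlib.Order.Interval.Finset.Nat
import Mathlib.Tactic.Linarith
import Mathlib.Tactic.LinearCombination
import Mathlib.Tactic.Ring
import Mathlib.Tactic.Push

/-!
# Discrete Sturm comparison for tilted Jacobi matrices ⇒ monotone likelihood ratio ⇒ TP₂ Gram kernel

The one-dimensional mechanism behind total positivity of ground-state overlap kernels
(Gantmacher–Krein oscillation theory; Karlin's sign-regularity), in the elementary form used by the
THEORY seat `hubbard-h0-rotor-theory-1` (memo ROTOR-THEORY-6 §61, `Sketch6.lean` §GramCauchyBinet +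
§JacobiSturm, kernel-checked there; transplanted verbatim up to inlining the discrete Wronskian).

Setting: a Jacobi matrix on the sites `1, …, n` with off-diagonal couplings `a k` (between `k` and
`k+1`), diagonal `b`, Dirichlet padding (`ψ 0 = ψ (n+1) = 0`), and a diagonal TILT `s · V` with `V`
non-decreasing along the chain; `ψ` an entrywise positive eigenvector of `−J + sV`:
`a(k−1)ψ(k−1) + b(k)ψ(k) + a(k)ψ(k+1) = (s V(k) − E) ψ(k)`.

* `gram_minor_eq_half_sum` — the `2 × 2` Cauchy–Binet (Lagrange) identity for Gram minors;
  `gram_tp2_of_sameSign` — same-signed `2 × 2` minors of two pairs of vectors ⇒ non-negative Gram minor.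
* (private) `partialSum_nonpos_of_monotone` — partial sums of `p_j g_j` (`p ≥ 0`, `g` non-decreasing,
  total `0`) are `≤ 0`.
* `jacobi_wronskian_step`, `jacobi_wronskian_eq_sum` — the discrete Wronskian
  `W(k) = a(k)(ψ(k)φ(k+1) − ψ(k+1)φ(k))` of eigenvectors at tilts `s, t` telescopes:
  `W(k) − W(k−1) = ψ(k)φ(k)((t−s)V(k) − (E_t − E_s))`.
* `jacobi_mlr` — **discrete Sturm comparison ⇒ MLR**: for `s ≤ t` and positive Dirichlet eigenvectors,
  `ψ(k)φ(k+1) ≤ ψ(k+1)φ(k)` (the likelihood ratio `φ/ψ` is non-increasing along the chain);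
  `jacobi_mlr_pairs` — all pairs `k ≤ l`.
* `jacobi_gramTP2` — **TP₂ of the overlap kernel**: positive Dirichlet eigenvectors `ψ₁, ψ₂` at tilts
  `s₁ ≤ s₂` and `φ₁, φ₂` at `t₁ ≤ t₂` satisfy `⟨ψ₁,φ₂⟩⟨ψ₂,φ₁⟩ ≤ ⟨ψ₁,φ₁⟩⟨ψ₂,φ₂⟩`.

References: F. Gantmacher, M. Krein, *Oscillation Matrices and Kernels and Small Vibrations of
Mechanical Systems* (AMS Chelsea 2002), Ch. II (Jacobi matrices, Sturm sequences); S. Karlin,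
*Total Positivity* I (1968), Ch. 3 (sign-regular kernels, composition formula).  Deliberately NOT
here: the lattice applications (exact lumping of XXZ sectors to birth–death chains), which live under
`Summits/HubbardSuperconductivity/…`.  No definition is introduced (the Wronskian is written out).
-/

namespace Literature.Analysis.TotalPositivity

/-! ### Cauchy–Binet for `2 × 2` Gram minors -/

/-- **Cauchy–Binet for `2 × 2` Gram minors (Lagrange identity)**:
`(Σ x y)(Σ u v) − (Σ x v)(Σ u y) = ½ Σ_k Σ_l (x_k u_l − x_l u_k)(y_k v_l − y_l v_k)`.
[cite: Karlin1968, Ch. 3 §1 (composition formula)] -/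
theorem gram_minor_eq_half_sum {ι : Type*} (S : Finset ι) (x u y v : ι → ℝ) :
    (∑ k ∈ S, x k * y k) * (∑ k ∈ S, u k * v k) - (∑ k ∈ S, x k * v k) * (∑ k ∈ S, u k * y k)
      = (1 / 2) * ∑ k ∈ S, ∑ l ∈ S, (x k * u l - x l * u k) * (y k * v l - y l * v k) := by
  have e1 : ∑ k ∈ S, ∑ l ∈ S, (x k * u l - x l * u k) * (y k * v l - y l * v k)
      = ∑ k ∈ S, ∑ l ∈ S, (x k * y k * (u l * v l) + x l * y l * (u k * v k))
        - ∑ k ∈ S, ∑ l ∈ S, (x k * v k * (u l * y l) + x l * v l * (u k * y k)) := by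
    rw [← Finset.sum_sub_distrib]
    refine Finset.sum_congr rfl fun k _ => ?_
    rw [← Finset.sum_sub_distrib]
    refine Finset.sum_congr rfl fun l _ => ?_
    ring
  have e2 : ∑ k ∈ S, ∑ l ∈ S, (x k * y k * (u l * v l) + x l * y l * (u k * v k))
      = 2 * ((∑ k ∈ S, x k * y k) * (∑ k ∈ S, u k * v k)) := by
    simp only [Finset.sum_add_distrib]
    rw [Finset.sum_comm (f := fun k l => x l * y l * (u k * v k))]
    simp only [← Finset.mul_sum, ← Finset.sum_mul]
    ring
  have e3 : ∑ k ∈ S, ∑ l ∈ S, (x k * v k * (u l * y l) + x l * v l * (u k * y k))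
      = 2 * ((∑ k ∈ S, x k * v k) * (∑ k ∈ S, u k * y k)) := by
    simp only [Finset.sum_add_distrib]
    rw [Finset.sum_comm (f := fun k l => x l * v l * (u k * y k))]
    simp only [← Finset.mul_sum, ← Finset.sum_mul]
    ring
  rw [e1, e2, e3]; ring

/-- **Same-signed minors ⇒ non-negative Gram minor** (basic composition lemma of sign-regular
kernels): if `(x_k u_l − x_l u_k)(y_k v_l − y_l v_k) ≥ 0` for all `k, l`, then
`(Σ x v)(Σ u y) ≤ (Σ x y)(Σ u v)`. [cite: Karlin1968, Ch. 3 §1] -/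
theorem gram_tp2_of_sameSign {ι : Type*} (S : Finset ι) (x u y v : ι → ℝ)
    (h : ∀ k ∈ S, ∀ l ∈ S, 0 ≤ (x k * u l - x l * u k) * (y k * v l - y l * v k)) :
    (∑ k ∈ S, x k * v k) * (∑ k ∈ S, u k * y k) ≤ (∑ k ∈ S, x k * y k) * (∑ k ∈ S, u k * v k) := by
  have := gram_minor_eq_half_sum S x u y v
  have hnn : 0 ≤ ∑ k ∈ S, ∑ l ∈ S, (x k * u l - x l * u k) * (y k * v l - y l * v k) :=
    Finset.sum_nonneg fun k hk => Finset.sum_nonneg fun l hl => h k hk l hl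
  linarith

/-! ### Discrete Sturm comparison for tilted Jacobi matrices -/

/-- Partial sums of a sequence `p_j g_j` with `p_j ≥ 0`, `g` non-decreasing on `[1, n]`, and total
`Σ_{j=1}^{n} p_j g_j = 0`, are non-positive (private helper). [folklore] -/
private theorem partialSum_nonpos_of_monotone {n : ℕ} (p g : ℕ → ℝ) (hp : ∀ j, 1 ≤ j → j ≤ n → 0 ≤ p j)
    (hg : ∀ i j, 1 ≤ i → i ≤ j → j ≤ n → g i ≤ g j)
    (htot : ∑ j ∈ Finset.Icc 1 n, p j * g j = 0) (k : ℕ) (hk : k ≤ n) :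
    ∑ j ∈ Finset.Icc 1 k, p j * g j ≤ 0 := by
  by_cases hneg : ∀ j, 1 ≤ j → j ≤ k → g j ≤ 0
  · apply Finset.sum_nonpos
    intro j hj
    rw [Finset.mem_Icc] at hj
    exact mul_nonpos_of_nonneg_of_nonpos (hp j hj.1 (hj.2.trans hk)) (hneg j hj.1 hj.2)
  · push Not at hneg
    obtain ⟨j₀, hj1, hjk, hgpos⟩ := hneg
    have hsplit : ∑ j ∈ Finset.Icc 1 n, p j * g j
        = ∑ j ∈ Finset.Icc 1 k, p j * g j + ∑ j ∈ Finset.Ioc k n, p j * g j := by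
      rw [← Finset.sum_union]
      · congr 1
        ext j; simp only [Finset.mem_Icc, Finset.mem_union, Finset.mem_Ioc]; omega
      · rw [Finset.disjoint_left]; intro j h1 h2
        simp only [Finset.mem_Icc, Finset.mem_Ioc] at h1 h2; omega
    have htail : 0 ≤ ∑ j ∈ Finset.Ioc k n, p j * g j := by
      apply Finset.sum_nonneg
      intro j hj; rw [Finset.mem_Ioc] at hj
      have : 0 ≤ g j := hgpos.le.trans (hg j₀ j hj1 (by omega) hj.2)
      exact mul_nonneg (hp j (by omega) hj.2) this
    linarith

variable {n : ℕ} {a b V ψ φ : ℕ → ℝ} {s t Es Et : ℝ}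

/-- **Wronskian step.**  For eigenvectors `ψ` of `−J + sV` (energy `Es`) and `φ` of `−J + tV`
(energy `Et`), `(Jf)(k) = a(k−1)f(k−1) + b(k)f(k) + a(k)f(k+1)`, the discrete Wronskian
`W(k) = a(k)(ψ(k)φ(k+1) − ψ(k+1)φ(k))` satisfies
`W(k) − W(k−1) = ψ(k)φ(k)((t − s)V(k) − (Et − Es))`.
[cite: GantmacherKrein2002, Ch. II §1 (Jacobi matrices, Sturm sequences)] -/
theorem jacobi_wronskian_step
    (hψ : ∀ k, 1 ≤ k → k ≤ n → a (k - 1) * ψ (k - 1) + b k * ψ k + a k * ψ (k + 1) = (s * V k - Es) * ψ k)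
    (hφ : ∀ k, 1 ≤ k → k ≤ n → a (k - 1) * φ (k - 1) + b k * φ k + a k * φ (k + 1) = (t * V k - Et) * φ k)
    (k : ℕ) (hk1 : 1 ≤ k) (hkn : k ≤ n) :
    a k * (ψ k * φ (k + 1) - ψ (k + 1) * φ k) - a (k - 1) * (ψ (k - 1) * φ k - ψ k * φ (k - 1)) =
      ψ k * φ k * ((t - s) * V k - (Et - Es)) := by
  have h1 := hψ k hk1 hkn
  have h2 := hφ k hk1 hkn
  linear_combination (ψ k) * h2 - (φ k) * h1

/-- **Wronskian as a partial sum** (telescoping from `W(0) = 0`):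
`a(k)(ψ(k)φ(k+1) − ψ(k+1)φ(k)) = Σ_{j=1}^{k} ψ(j)φ(j)((t−s)V(j) − (Et−Es))`.
[cite: GantmacherKrein2002, Ch. II §1] -/
theorem jacobi_wronskian_eq_sum
    (hψ : ∀ k, 1 ≤ k → k ≤ n → a (k - 1) * ψ (k - 1) + b k * ψ k + a k * ψ (k + 1) = (s * V k - Es) * ψ k)
    (hφ : ∀ k, 1 ≤ k → k ≤ n → a (k - 1) * φ (k - 1) + b k * φ k + a k * φ (k + 1) = (t * V k - Et) * φ k)
    (h0 : a 0 * (ψ 0 * φ 1 - ψ 1 * φ 0) = 0) (k : ℕ) (hkn : k ≤ n) :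
    a k * (ψ k * φ (k + 1) - ψ (k + 1) * φ k) =
      ∑ j ∈ Finset.Icc 1 k, ψ j * φ j * ((t - s) * V j - (Et - Es)) := by
  induction k with
  | zero => simpa using h0
  | succ m ih =>
    have hm : m ≤ n := by omega
    rw [Finset.sum_Icc_succ_top (by omega), ← ih hm]
    have := jacobi_wronskian_step hψ hφ (m + 1) (by omega) hkn
    simp only [Nat.add_sub_cancel] at this
    linarith

/-- **DISCRETE STURM COMPARISON ⇒ MLR.**  Jacobi matrix on `1..n` (`a k > 0` couples `k, k+1`;
Dirichlet padding `ψ 0 = ψ (n+1) = 0`), `V` NON-DECREASING along the chain, tilts `s ≤ t`, `ψ > 0` an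
eigenvector of `−J + sV`, `φ > 0` one of `−J + tV`.  Then `ψ(k)φ(k+1) ≤ ψ(k+1)φ(k)` for
`1 ≤ k < n`: the likelihood ratio `φ/ψ` is non-increasing along the chain (the larger tilt pushes the
positive eigenvector towards small `V`).  [cite: GantmacherKrein2002, Ch. II (oscillation theorems
for Jacobi matrices)] -/
theorem jacobi_mlr (ha : ∀ k, 1 ≤ k → k < n → 0 < a k)
    (hV : ∀ i j, 1 ≤ i → i ≤ j → j ≤ n → V i ≤ V j) (hst : s ≤ t)
    (hψpos : ∀ k, 1 ≤ k → k ≤ n → 0 < ψ k) (hφpos : ∀ k, 1 ≤ k → k ≤ n → 0 < φ k)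
    (hψ0 : ψ 0 = 0) (hφ0 : φ 0 = 0) (hψn : ψ (n + 1) = 0) (hφn : φ (n + 1) = 0)
    (hψ : ∀ k, 1 ≤ k → k ≤ n → a (k - 1) * ψ (k - 1) + b k * ψ k + a k * ψ (k + 1) = (s * V k - Es) * ψ k)
    (hφ : ∀ k, 1 ≤ k → k ≤ n → a (k - 1) * φ (k - 1) + b k * φ k + a k * φ (k + 1) = (t * V k - Et) * φ k)
    (k : ℕ) (hk1 : 1 ≤ k) (hkn : k < n) :
    ψ k * φ (k + 1) ≤ ψ (k + 1) * φ k := by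
  have h0 : a 0 * (ψ 0 * φ 1 - ψ 1 * φ 0) = 0 := by simp [hψ0, hφ0]
  have hWn : a n * (ψ n * φ (n + 1) - ψ (n + 1) * φ n) = 0 := by simp [hψn, hφn]
  have htot : ∑ j ∈ Finset.Icc 1 n, ψ j * φ j * ((t - s) * V j - (Et - Es)) = 0 := by
    rw [← jacobi_wronskian_eq_sum hψ hφ h0 n le_rfl, hWn]
  have hW : a k * (ψ k * φ (k + 1) - ψ (k + 1) * φ k) ≤ 0 := by
    rw [jacobi_wronskian_eq_sum hψ hφ h0 k hkn.le]
    refine partialSum_nonpos_of_monotone (n := n) (fun j => ψ j * φ j)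
      (fun j => (t - s) * V j - (Et - Es)) ?_ ?_ htot k hkn.le
    · intro j hj1 hjn; exact (mul_pos (hψpos j hj1 hjn) (hφpos j hj1 hjn)).le
    · intro i j hi hij hjn
      have := hV i j hi hij hjn
      have hts : 0 ≤ t - s := sub_nonneg.2 hst
      nlinarith
  have hak := ha k hk1 hkn
  by_contra hcon
  push Not at hcon
  have : 0 < a k * (ψ k * φ (k + 1) - ψ (k + 1) * φ k) := mul_pos hak (by linarith)
  linarith

/-- **MLR for all pairs** `1 ≤ k ≤ l ≤ n` (cross-multiplied): `ψ(k)φ(l) ≤ ψ(l)φ(k)`.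
[cite: GantmacherKrein2002, Ch. II] -/
theorem jacobi_mlr_pairs (ha : ∀ k, 1 ≤ k → k < n → 0 < a k)
    (hV : ∀ i j, 1 ≤ i → i ≤ j → j ≤ n → V i ≤ V j) (hst : s ≤ t)
    (hψpos : ∀ k, 1 ≤ k → k ≤ n → 0 < ψ k) (hφpos : ∀ k, 1 ≤ k → k ≤ n → 0 < φ k)
    (hψ0 : ψ 0 = 0) (hφ0 : φ 0 = 0) (hψn : ψ (n + 1) = 0) (hφn : φ (n + 1) = 0)
    (hψ : ∀ k, 1 ≤ k → k ≤ n → a (k - 1) * ψ (k - 1) + b k * ψ k + a k * ψ (k + 1) = (s * V k - Es) * ψ k)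
    (hφ : ∀ k, 1 ≤ k → k ≤ n → a (k - 1) * φ (k - 1) + b k * φ k + a k * φ (k + 1) = (t * V k - Et) * φ k)
    (k l : ℕ) (hk1 : 1 ≤ k) (hkl : k ≤ l) (hln : l ≤ n) :
    ψ k * φ l ≤ ψ l * φ k := by
  have key : ∀ m, k ≤ m → m ≤ n → φ m / ψ m ≤ φ k / ψ k := by
    intro m hkm hmn
    induction m, hkm using Nat.le_induction with
    | base => exact le_rfl
    | succ m hkm ih =>
      have hmn' : m < n := by omega
      have step := jacobi_mlr ha hV hst hψpos hφpos hψ0 hφ0 hψn hφn hψ hφ m (by omega) hmn'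
      have hψm := hψpos m (by omega) hmn'.le
      have hψm1 := hψpos (m + 1) (by omega) hmn
      have : φ (m + 1) / ψ (m + 1) ≤ φ m / ψ m := by
        rw [div_le_div_iff₀ hψm1 hψm]; linarith
      exact this.trans (ih hmn'.le)
  have hψk := hψpos k hk1 (hkl.trans hln)
  have hψl := hψpos l (by omega) hln
  have := key l hkl hln
  rw [div_le_div_iff₀ hψl hψk] at this
  linarith

/-- **THEOREM (monotone Jacobi tilt ⇒ TP₂ overlap kernel).**  For a Jacobi matrix with a
non-decreasing diagonal tilt `V`, positive Dirichlet eigenvectors `ψ₁, ψ₂` at tilts `s₁ ≤ s₂` and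
`φ₁, φ₂` at tilts `t₁ ≤ t₂` satisfy `⟨ψ₁,φ₂⟩⟨ψ₂,φ₁⟩ ≤ ⟨ψ₁,φ₁⟩⟨ψ₂,φ₂⟩` (sums over the sites `1..n`):
discrete Sturm comparison makes both kernels `(tilt, site) ↦ eigenvector` sign-regular of order two
with the same sign (`jacobi_mlr_pairs`), and the `2 × 2` Cauchy–Binet identity concludes
(`gram_tp2_of_sameSign`).  Theory seat `hubbard-h0-rotor-theory-1`, memo ROTOR-THEORY-6 §61.
[cite: Karlin1968, Ch. 3 §1; GantmacherKrein2002, Ch. II] -/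
theorem jacobi_gramTP2 (ha : ∀ k, 1 ≤ k → k < n → 0 < a k)
    (hV : ∀ i j, 1 ≤ i → i ≤ j → j ≤ n → V i ≤ V j)
    {s₁ s₂ t₁ t₂ E₁ E₂ F₁ F₂ : ℝ} (hs : s₁ ≤ s₂) (ht : t₁ ≤ t₂)
    {ψ₁ ψ₂ φ₁ φ₂ : ℕ → ℝ}
    (pψ₁ : ∀ k, 1 ≤ k → k ≤ n → 0 < ψ₁ k) (pψ₂ : ∀ k, 1 ≤ k → k ≤ n → 0 < ψ₂ k)
    (pφ₁ : ∀ k, 1 ≤ k → k ≤ n → 0 < φ₁ k) (pφ₂ : ∀ k, 1 ≤ k → k ≤ n → 0 < φ₂ k)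
    (zψ₁ : ψ₁ 0 = 0 ∧ ψ₁ (n + 1) = 0) (zψ₂ : ψ₂ 0 = 0 ∧ ψ₂ (n + 1) = 0)
    (zφ₁ : φ₁ 0 = 0 ∧ φ₁ (n + 1) = 0) (zφ₂ : φ₂ 0 = 0 ∧ φ₂ (n + 1) = 0)
    (eψ₁ : ∀ k, 1 ≤ k → k ≤ n →
      a (k - 1) * ψ₁ (k - 1) + b k * ψ₁ k + a k * ψ₁ (k + 1) = (s₁ * V k - E₁) * ψ₁ k)
    (eψ₂ : ∀ k, 1 ≤ k → k ≤ n →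
      a (k - 1) * ψ₂ (k - 1) + b k * ψ₂ k + a k * ψ₂ (k + 1) = (s₂ * V k - E₂) * ψ₂ k)
    (eφ₁ : ∀ k, 1 ≤ k → k ≤ n →
      a (k - 1) * φ₁ (k - 1) + b k * φ₁ k + a k * φ₁ (k + 1) = (t₁ * V k - F₁) * φ₁ k)
    (eφ₂ : ∀ k, 1 ≤ k → k ≤ n →
      a (k - 1) * φ₂ (k - 1) + b k * φ₂ k + a k * φ₂ (k + 1) = (t₂ * V k - F₂) * φ₂ k) :
    (∑ k ∈ Finset.Icc 1 n, ψ₁ k * φ₂ k) * (∑ k ∈ Finset.Icc 1 n, ψ₂ k * φ₁ k)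
      ≤ (∑ k ∈ Finset.Icc 1 n, ψ₁ k * φ₁ k) * (∑ k ∈ Finset.Icc 1 n, ψ₂ k * φ₂ k) := by
  apply gram_tp2_of_sameSign
  intro k hk l hl
  rw [Finset.mem_Icc] at hk hl
  rcases le_total k l with hkl | hlk
  · have e1 := jacobi_mlr_pairs ha hV hs pψ₁ pψ₂ zψ₁.1 zψ₂.1 zψ₁.2 zψ₂.2 eψ₁ eψ₂ k l hk.1 hkl hl.2
    have e2 := jacobi_mlr_pairs ha hV ht pφ₁ pφ₂ zφ₁.1 zφ₂.1 zφ₁.2 zφ₂.2 eφ₁ eφ₂ k l hk.1 hkl hl.2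
    exact mul_nonneg_of_nonpos_of_nonpos (by linarith) (by linarith)
  · have e1 := jacobi_mlr_pairs ha hV hs pψ₁ pψ₂ zψ₁.1 zψ₂.1 zψ₁.2 zψ₂.2 eψ₁ eψ₂ l k hl.1 hlk hk.2
    have e2 := jacobi_mlr_pairs ha hV ht pφ₁ pφ₂ zφ₁.1 zφ₂.1 zφ₁.2 zφ₂.2 eφ₁ eφ₂ l k hl.1 hlk hk.2
    exact mul_nonneg (by linarith) (by linarith)

end Literature.Analysis.TotalPositivity
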